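import Summits.RiemannHypothesis.RiemannHypothesis.Theorems.UniversalFactorNarrowKernelNoGoConvolution
import Summits.RiemannHypothesis.RiemannHypothesis.Theorems.UniversalFactorNarrowKernelNoGoEnergyLowerKernel
import Literature.NumberTheory.LFunctions.ZetaCriticalLineWeightedMeanSquare
import Literature.NumberTheory.LFunctions.ZetaMeanSquareLowerBound

/-!
# RiemannHypothesis / UniversalFactor — `NarrowKernelNoGo` (stmt-RiemannHypothesis-2576), line `Sketch`:
# stub K1a-reduction, part 1 — crude mean square of `Z` and the kernel of the remainder

Route `RiemannHypothesis/UniversalFactor`, crux `NarrowKernelNoGo`, registered stub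
`UniversalFactor.stub_narrowEnergyLowerReduction` (proved in
`UniversalFactorNarrowKernelNoGoEnergyLowerReduction.lean`, which imports this file). Notation:
`E(τ) = ‖γ(1/2 + iτ)‖` (`γ = xiGammaFactor`), `Z = hardyZ`, `w(t) = t^{-7/4} e^{πt/4}`,
`κ_a(u) = e^{−2a|u|} e^{−πu/4}` (the tilted Laplace kernel, `a > π/8`),
`I₀(t) = ∫ e^{−2a|u|} E(t+u) Z(t+u) du`, `g(t) = ∫ κ_a(u) Z(t+u) du`. This file proves:

* `UniversalFactor.narrowRed_hardyZ_meanSquare`, `UniversalFactor.narrowRed_meanSquareShift`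
  (registered sub-stub) — the CRUDE mean square `∫_{-X}^{X} Z² ≤ C(1+X)(1+log X)³` and its shifted
  form `∫_T^{2T} Z(t+u)² dt ≤ C(1+2T)(1+log 2T)³(1+|u|)⁴`, from the tree's weighted mean square
  `∫ |ζ(1/2+it)|²/(1+|t|) ≪ log³` (`exists_integral_norm_sq_zeta_half_div_le_symm`);
* `UniversalFactor.narrowRed_integrable_section`, `UniversalFactor.narrowRed_continuous_conv` —
  integrability of `u ↦ (1+|u|)^k κ_a(u) φ(t+u)` and continuity of `t ↦ ∫ κ_a(u) φ(t+u) du` for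
  `φ` continuous of polynomial growth; `UniversalFactor.narrowRed_continuous_I₀`;
* `UniversalFactor.narrowRed_remainder_eq` — `I₀ w − c₀ g = ∫ e^{−2a|u|} θ(t,u) Z(t+u) du`,
  `θ(t,u) = E(t+u)w(t) − c₀e^{−πu/4}`;
* `UniversalFactor.narrowRed_kernel_bound` — under the `ξ`-envelope facts,
  `|e^{−2a|u|} θ(t,u)| ≤ (D/t)(1+|u|)⁴ κ_a(u)` for `t ≥ max(T₀,1)` and ALL `u` (no splitting of the
  `u`-integral is needed downstream).

References: Titchmarsh, *The Theory of the Riemann Zeta-Function* (1986), §2.12, §4.17, Thm. 7.3.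
-/

noncomputable section

-- D-0017: `Summit.<S>.<S>.…` is the designed namespace of a single-problem summit.
set_option linter.dupNamespace false

namespace Summit.RiemannHypothesis.RiemannHypothesis.Theorems

open MeasureTheory Set Filter Complex intervalIntegral
open scoped Real Topology
open Literature.NumberTheory.LFunctions

-- the tilted kernel `κ_a(u) = e^{−2a|u|} e^{−πu/4}` (local notation of this file)
local notation "KT(" a ", " u ")" => Real.exp (-(2 * a * |u|)) * Real.exp (-(π * u / 4))

/-! ## Crude facts about Hardy's `Z` -/

/-- `Z(t)² = |ζ(1/2 + it)|²`. [cite: Titchmarsh1986, §4.17] -/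
theorem UniversalFactor.narrowRed_hardyZ_sq (t : ℝ) :
    hardyZ t ^ 2 = ‖riemannZeta (1 / 2 + t * I)‖ ^ 2 := by
  rw [← abs_hardyZ_eq_norm_riemannZeta_holds t, sq_abs]

/-- `|Z(τ)| ≤ 2 + 2|τ| ≤ 2(1 + |τ|)` (Titchmarsh (2.12.2) on the critical line).
[cite: Titchmarsh1986, §2.12 eq. (2.12.2)] -/
theorem UniversalFactor.narrowRed_abs_hardyZ_le (τ : ℝ) : |hardyZ τ| ≤ 2 * (1 + |τ|) ^ 1 := by
  rw [abs_hardyZ_eq_norm_riemannZeta_holds τ, pow_one, mul_add, mul_one]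
  exact ZetaMeanSquare.norm_riemannZeta_line_le τ

/-- `Z(τ)² ≤ 4(1 + |τ|)²`. [folklore] -/
theorem UniversalFactor.narrowRed_hardyZ_sq_le (τ : ℝ) : |hardyZ τ ^ 2| ≤ 4 * (1 + |τ|) ^ 2 := by
  rw [abs_of_nonneg (sq_nonneg _), ← sq_abs]
  have h := UniversalFactor.narrowRed_abs_hardyZ_le τ
  rw [pow_one] at h
  have h0 : 0 ≤ |hardyZ τ| := abs_nonneg _
  nlinarith

/-- **Crude mean square of `Z`** (one logarithm weaker than Hardy–Littlewood):
`∫_{-X}^{X} Z(s)² ds ≤ C (1 + X)(1 + log X)³` for `X ≥ 1`, from the tree's weighted mean square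
`∫_{-X}^{X} |ζ(1/2+is)|²/(1+|s|) ds ≪ (1 + log X)³`. [cite: Titchmarsh1986, Thm. 7.3 (weak form)] -/
theorem UniversalFactor.narrowRed_hardyZ_meanSquare :
    ∃ C : ℝ, 0 < C ∧ ∀ X : ℝ, 1 ≤ X →
      ∫ s in (-X)..X, hardyZ s ^ 2 ≤ C * (1 + X) * (1 + Real.log X) ^ 3 := by
  obtain ⟨C, hC, h⟩ := exists_integral_norm_sq_zeta_half_div_le_symm
  refine ⟨C, hC, fun X hX => ?_⟩
  calc ∫ s in (-X)..X, hardyZ s ^ 2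
      ≤ ∫ s in (-X)..X, (1 + X) * (‖riemannZeta (1 / 2 + s * I)‖ ^ 2 / (1 + |s|)) := by
        refine intervalIntegral.integral_mono_on (by linarith) ?_ ?_ fun s hs => ?_
        · exact (continuous_hardyZ.fun_pow 2).intervalIntegrable _ _
        · exact (continuous_const.fun_mul continuous_norm_sq_zeta_half_div).intervalIntegrable _ _
        · have h1 : |s| ≤ X := abs_le.2 ⟨hs.1, hs.2⟩
          have h2 : (0 : ℝ) < 1 + |s| := by positivity
          have h3 : (1 + |s|) * (‖riemannZeta (1 / 2 + s * I)‖ ^ 2 / (1 + |s|)) =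
              ‖riemannZeta (1 / 2 + s * I)‖ ^ 2 := by
            field_simp
          calc hardyZ s ^ 2 = ‖riemannZeta (1 / 2 + s * I)‖ ^ 2 := UniversalFactor.narrowRed_hardyZ_sq s
            _ = (1 + |s|) * (‖riemannZeta (1 / 2 + s * I)‖ ^ 2 / (1 + |s|)) := h3.symm
            _ ≤ (1 + X) * (‖riemannZeta (1 / 2 + s * I)‖ ^ 2 / (1 + |s|)) :=
                mul_le_mul_of_nonneg_right (by linarith) (by positivity)
    _ = (1 + X) * ∫ s in (-X)..X, ‖riemannZeta (1 / 2 + s * I)‖ ^ 2 / (1 + |s|) :=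
        intervalIntegral.integral_const_mul _ _
    _ ≤ (1 + X) * (C * (1 + Real.log X) ^ 3) := mul_le_mul_of_nonneg_left (h X hX) (by linarith)
    _ = C * (1 + X) * (1 + Real.log X) ^ 3 := by ring

/-- `1 + log(2T + |u|) ≤ (1 + log 2T)(1 + |u|)` for `T ≥ 1/2`. [folklore] -/
theorem UniversalFactor.narrowRed_log_shift_le {T : ℝ} (hT : 1 / 2 ≤ T) (u : ℝ) :
    1 + Real.log (2 * T + |u|) ≤ (1 + Real.log (2 * T)) * (1 + |u|) := by
  have hu : 0 ≤ |u| := abs_nonneg u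
  have h2T : 1 ≤ 2 * T := by linarith
  have hlog0 : 0 ≤ Real.log (2 * T) := Real.log_nonneg h2T
  have h1 : 2 * T + |u| ≤ 2 * T * (1 + |u|) := by nlinarith
  have h2 : Real.log (2 * T + |u|) ≤ Real.log (2 * T) + |u| := by
    calc Real.log (2 * T + |u|) ≤ Real.log (2 * T * (1 + |u|)) :=
          Real.log_le_log (by positivity) h1
      _ = Real.log (2 * T) + Real.log (1 + |u|) := Real.log_mul (by positivity) (by positivity)
      _ ≤ Real.log (2 * T) + |u| := by
          have := Real.log_le_sub_one_of_pos (by positivity : (0 : ℝ) < 1 + |u|)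
          linarith
  nlinarith

/-- **Shifted crude mean square**: `∫_T^{2T} Z(t+u)² dt ≤ C (1 + 2T)(1 + log 2T)³ (1 + |u|)⁴` for
`T ≥ 1` and all real `u` (`[T+u, 2T+u] ⊆ [−(2T+|u|), 2T+|u|]`). [folklore] -/
theorem UniversalFactor.narrowRed_hardyZ_meanSquare_shift :
    ∃ C : ℝ, 0 < C ∧ ∀ T : ℝ, 1 ≤ T → ∀ u : ℝ,
      ∫ t in T..2 * T, hardyZ (t + u) ^ 2 ≤
        C * (1 + 2 * T) * (1 + Real.log (2 * T)) ^ 3 * (1 + |u|) ^ 4 := by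
  obtain ⟨C, hC, h⟩ := UniversalFactor.narrowRed_hardyZ_meanSquare
  refine ⟨C, hC, fun T hT u => ?_⟩
  have hu : 0 ≤ |u| := abs_nonneg u
  set X : ℝ := 2 * T + |u| with hX
  have hX1 : 1 ≤ X := by linarith
  have hshift : ∫ t in T..2 * T, hardyZ (t + u) ^ 2 = ∫ s in (T + u)..(2 * T + u), hardyZ s ^ 2 :=
    intervalIntegral.integral_comp_add_right (fun s => hardyZ s ^ 2) u
  have hsub : ∫ s in (T + u)..(2 * T + u), hardyZ s ^ 2 ≤ ∫ s in (-X)..X, hardyZ s ^ 2 := by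
    refine intervalIntegral.integral_mono_interval ?_ (by linarith) ?_
      (Eventually.of_forall fun s => sq_nonneg _) ((continuous_hardyZ.fun_pow 2).intervalIntegrable _ _)
    · have := neg_abs_le u; linarith
    · have := le_abs_self u; linarith
  have h1 : 1 + X ≤ (1 + 2 * T) * (1 + |u|) := by rw [hX]; nlinarith
  have h2 : 1 + Real.log X ≤ (1 + Real.log (2 * T)) * (1 + |u|) :=
    UniversalFactor.narrowRed_log_shift_le (by linarith) u
  have h3 : 0 ≤ 1 + Real.log X := by have := Real.log_nonneg hX1; linarith
  rw [hshift]
  calc ∫ s in (T + u)..(2 * T + u), hardyZ s ^ 2 ≤ ∫ s in (-X)..X, hardyZ s ^ 2 := hsub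
    _ ≤ C * (1 + X) * (1 + Real.log X) ^ 3 := h X hX1
    _ ≤ C * ((1 + 2 * T) * (1 + |u|)) * ((1 + Real.log (2 * T)) * (1 + |u|)) ^ 3 := by
        have h4 : (1 + Real.log X) ^ 3 ≤ ((1 + Real.log (2 * T)) * (1 + |u|)) ^ 3 :=
          pow_le_pow_left₀ h3 h2 3
        have h5 : C * (1 + X) ≤ C * ((1 + 2 * T) * (1 + |u|)) := mul_le_mul_of_nonneg_left h1 hC.le
        exact mul_le_mul h5 h4 (pow_nonneg h3 3) (by positivity)
    _ = C * (1 + 2 * T) * (1 + Real.log (2 * T)) ^ 3 * (1 + |u|) ^ 4 := by ring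

/-- **Registered sub-stub `narrowRed_meanSquareShift`** (verbatim signature): the shifted crude mean
square of Hardy's function, `∫_T^{2T} Z(t+u)² dt ≤ C (1 + 2T)(1 + log 2T)³ (1 + |u|)⁴` (`T ≥ 1`).
[cite: Titchmarsh1986, Thm. 7.3 (weak form)] -/
theorem UniversalFactor.narrowRed_meanSquareShift : ∃ C : ℝ, 0 < C ∧ ∀ T : ℝ, 1 ≤ T → ∀ u : ℝ, ∫ t in T..2 * T, hardyZ (t + u) ^ 2 ≤ C * (1 + 2 * T) * (1 + Real.log (2 * T)) ^ 3 * (1 + |u|) ^ 4 :=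
  UniversalFactor.narrowRed_hardyZ_meanSquare_shift

/-! ## Integrability and continuity of the kernel integrals -/

/-- For `φ` continuous of polynomial growth `|φ(τ)| ≤ A(1+|τ|)^m`, the section
`u ↦ (1+|u|)^k κ_a(u) φ(t+u)` is integrable (`a > π/8`). [folklore] -/
theorem UniversalFactor.narrowRed_integrable_section {a : ℝ} (ha : π / 8 < a) {φ : ℝ → ℝ}
    (hφ : Continuous φ) {A : ℝ} {m : ℕ} (hb : ∀ τ, |φ τ| ≤ A * (1 + |τ|) ^ m) (k : ℕ) (t : ℝ) :
    Integrable fun u : ℝ => (1 + |u|) ^ k * KT(a, u) * φ (t + u) := by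
  have hA : 0 ≤ A := by
    have h := (abs_nonneg _).trans (hb 0)
    simpa using h
  have hint := (UniversalFactor.narrow_integrable_pow_mul_ker ha (k + m)).const_mul (A * (1 + |t|) ^ m)
  refine hint.mono' ?_ (Eventually.of_forall fun u => ?_)
  · exact ((by fun_prop : Continuous fun u : ℝ => (1 + |u|) ^ k * KT(a, u)).mul
      (hφ.comp (continuous_const.add continuous_id))).aestronglyMeasurable
  have hκ := UniversalFactor.narrowKer_pos a u
  have hu : 0 ≤ |u| := abs_nonneg u
  have ht : 0 ≤ |t| := abs_nonneg t
  rw [Real.norm_eq_abs, abs_mul, abs_of_pos (by positivity : 0 < (1 + |u|) ^ k * KT(a, u))]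
  have h1 : |φ (t + u)| ≤ A * ((1 + |t|) ^ m * (1 + |u|) ^ m) := by
    refine (hb (t + u)).trans (mul_le_mul_of_nonneg_left ?_ hA)
    rw [← mul_pow]
    refine pow_le_pow_left₀ (by positivity) ?_ m
    have := abs_add_le t u
    nlinarith
  calc (1 + |u|) ^ k * KT(a, u) * |φ (t + u)|
      ≤ (1 + |u|) ^ k * KT(a, u) * (A * ((1 + |t|) ^ m * (1 + |u|) ^ m)) :=
        mul_le_mul_of_nonneg_left h1 (by positivity)
    _ = A * (1 + |t|) ^ m * ((1 + |u|) ^ (k + m) * KT(a, u)) := by ring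

/-- For `φ` continuous of polynomial growth, `t ↦ ∫ κ_a(u) φ(t+u) du` is continuous (`a > π/8`;
dominated convergence on unit balls). [folklore] -/
theorem UniversalFactor.narrowRed_continuous_conv {a : ℝ} (ha : π / 8 < a) {φ : ℝ → ℝ}
    (hφ : Continuous φ) {A : ℝ} {m : ℕ} (hb : ∀ τ, |φ τ| ≤ A * (1 + |τ|) ^ m) :
    Continuous fun t : ℝ => ∫ u : ℝ, KT(a, u) * φ (t + u) := by
  have hA : 0 ≤ A := by
    have h := (abs_nonneg _).trans (hb 0)
    simpa using h
  refine continuous_iff_continuousAt.2 fun t₀ => ?_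
  refine continuousAt_of_dominated
    (bound := fun u => A * (2 + |t₀|) ^ m * ((1 + |u|) ^ m * KT(a, u))) ?_ ?_ ?_ ?_
  · exact Eventually.of_forall fun t => ((by fun_prop : Continuous fun u : ℝ => KT(a, u)).mul
      (hφ.comp (continuous_const.add continuous_id))).aestronglyMeasurable
  · have hball : ∀ᶠ t in 𝓝 t₀, |t - t₀| < 1 := by
      have := Metric.ball_mem_nhds t₀ one_pos
      filter_upwards [this] with t ht
      rwa [Metric.mem_ball, Real.dist_eq] at ht
    filter_upwards [hball] with t ht
    refine Eventually.of_forall fun u => ?_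
    have hκ := UniversalFactor.narrowKer_pos a u
    have hu : 0 ≤ |u| := abs_nonneg u
    have ht₀ : 0 ≤ |t₀| := abs_nonneg t₀
    rw [Real.norm_eq_abs, abs_mul, abs_of_pos hκ]
    have h1 : |φ (t + u)| ≤ A * ((2 + |t₀|) ^ m * (1 + |u|) ^ m) := by
      refine (hb (t + u)).trans (mul_le_mul_of_nonneg_left ?_ hA)
      rw [← mul_pow]
      refine pow_le_pow_left₀ (by positivity) ?_ m
      have h2 := abs_add_le t u
      have h3 : |t| ≤ |t₀| + 1 := by
        have := abs_sub_abs_le_abs_sub t t₀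
        linarith
      nlinarith
    calc KT(a, u) * |φ (t + u)| ≤ KT(a, u) * (A * ((2 + |t₀|) ^ m * (1 + |u|) ^ m)) :=
          mul_le_mul_of_nonneg_left h1 hκ.le
      _ = A * (2 + |t₀|) ^ m * ((1 + |u|) ^ m * KT(a, u)) := by ring
  · exact (UniversalFactor.narrow_integrable_pow_mul_ker ha m).const_mul _
  · exact Eventually.of_forall fun u =>
      (continuous_const.mul (hφ.comp (continuous_id.add continuous_const))).continuousAt

/-- The section `u ↦ e^{−2a|u|} E(t+u) Z(t+u)` is integrable (`E Z` is bounded, `a > 0`).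
[folklore] -/
theorem UniversalFactor.narrowRed_integrable_KEZ {a : ℝ} (ha : 0 < a) (t : ℝ) :
    Integrable fun u : ℝ => Real.exp (-(2 * a * |u|)) *
      ‖xiGammaFactor (1 / 2 + ((t + u : ℝ) : ℂ) * I)‖ * hardyZ (t + u) := by
  obtain ⟨M, hM⟩ := UniversalFactor.narrowConv_EZ_bounded
  have hint : Integrable fun u : ℝ => Real.exp (-(2 * a * |u|)) * M :=
    (integrable_exp_neg_mul_abs (by positivity : 0 < 2 * a)).mul_const M
  have hc : Continuous fun u : ℝ =>
      ‖xiGammaFactor (1 / 2 + ((t + u : ℝ) : ℂ) * I)‖ * hardyZ (t + u) :=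
    UniversalFactor.narrowConv_EZ_continuous.comp (continuous_const.add continuous_id)
  have hint2 : Integrable fun u : ℝ => Real.exp (-(2 * a * |u|)) *
      (‖xiGammaFactor (1 / 2 + ((t + u : ℝ) : ℂ) * I)‖ * hardyZ (t + u)) := by
    refine hint.mono'
      ((by fun_prop : Continuous fun u : ℝ => Real.exp (-(2 * a * |u|))).mul hc).aestronglyMeasurable
      (Eventually.of_forall fun u => ?_)
    rw [Real.norm_eq_abs, abs_mul, abs_of_pos (Real.exp_pos _)]
    exact mul_le_mul_of_nonneg_left (hM (t + u)) (Real.exp_pos _).le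
  simpa only [mul_assoc] using hint2

/-- `t ↦ I₀(t) = ∫ e^{−2a|u|} E(t+u) Z(t+u) du` is continuous (it is differentiable,
`UniversalFactor.narrowConv_hasDerivAt_kernel`). [folklore] -/
theorem UniversalFactor.narrowRed_continuous_I₀ {a : ℝ} (ha : 0 < a) :
    Continuous fun t : ℝ => ∫ u : ℝ, Real.exp (-(2 * a * |u|)) *
      ‖xiGammaFactor (1 / 2 + ((t + u : ℝ) : ℂ) * I)‖ * hardyZ (t + u) := by
  obtain ⟨M, hM⟩ := UniversalFactor.narrowConv_EZ_bounded
  have hD : Differentiable ℝ fun s : ℝ => ∫ u : ℝ, Real.exp (-(2 * a * |u|)) *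
      (‖xiGammaFactor (1 / 2 + ((s + u : ℝ) : ℂ) * I)‖ * hardyZ (s + u)) := fun t =>
    (UniversalFactor.narrowConv_hasDerivAt_kernel (by positivity : 0 < 2 * a)
      UniversalFactor.narrowConv_EZ_continuous hM t).differentiableAt
  simpa only [mul_assoc] using hD.continuous

/-! ## Step 1: the remainder `r = I₀ w − c₀ g` as a kernel integral, and its kernel -/

/-- `I₀(t) w(t) − c₀ g(t) = ∫ e^{−2a|u|} (E(t+u) w(t) − c₀ e^{−πu/4}) Z(t+u) du`. [folklore] -/
theorem UniversalFactor.narrowRed_remainder_eq {a : ℝ} (ha : π / 8 < a) (c₀ t : ℝ) :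
    (∫ u : ℝ, Real.exp (-(2 * a * |u|)) *
        ‖xiGammaFactor (1 / 2 + ((t + u : ℝ) : ℂ) * I)‖ * hardyZ (t + u)) *
        (t ^ (-(7 : ℝ) / 4) * Real.exp (π * t / 4)) -
      c₀ * ∫ u : ℝ, KT(a, u) * hardyZ (t + u) =
    ∫ u : ℝ, Real.exp (-(2 * a * |u|)) *
      (‖xiGammaFactor (1 / 2 + ((t + u : ℝ) : ℂ) * I)‖ * (t ^ (-(7 : ℝ) / 4) * Real.exp (π * t / 4)) -
        c₀ * Real.exp (-(π * u / 4))) * hardyZ (t + u) := by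
  have ha0 : 0 < a := lt_trans (by positivity) ha
  have h1 := UniversalFactor.narrowRed_integrable_KEZ ha0 t
  have h2 : Integrable fun u : ℝ => KT(a, u) * hardyZ (t + u) := by
    simpa using UniversalFactor.narrowRed_integrable_section ha continuous_hardyZ
      UniversalFactor.narrowRed_abs_hardyZ_le 0 t
  rw [← MeasureTheory.integral_mul_const, ← MeasureTheory.integral_const_mul,
    ← integral_sub (h1.mul_const _) (h2.const_mul _)]
  refine integral_congr_ae (Eventually.of_forall fun u => ?_)
  ring

/-- **The kernel of the remainder.** With `θ(t,u) = E(t+u) w(t) − c₀ e^{−πu/4}`: for `t ≥ max(T₀, 1)`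
and all `u`, `|e^{−2a|u|} θ(t,u)| ≤ (D/t)(1+|u|)⁴ κ_a(u)`, `D = max(C,0) + 4(9C₀ + c₀)`
(`|u| ≤ t/2`: the envelope asymptotics; `|u| > t/2`: the global bound, `t + u ≤ |t+u|`,
`(1+|t+u|)^{7/4} t^{-7/4} ≤ 9(1+|u|)²` and `1 < (2(1+|u|)/t)²`). [folklore] -/
theorem UniversalFactor.narrowRed_kernel_bound {a C₀ c₀ C T₀ : ℝ}
    (hC₀ : ∀ τ : ℝ, ‖xiGammaFactor (1 / 2 + (τ : ℂ) * I)‖ ≤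
      C₀ * (1 + |τ|) ^ ((7 : ℝ) / 4) * Real.exp (-(π * |τ| / 4)))
    (hc₀ : 0 < c₀)
    (henv : ∀ t : ℝ, T₀ ≤ t → ∀ u : ℝ, |u| ≤ t / 2 →
      |‖xiGammaFactor (1 / 2 + ((t + u : ℝ) : ℂ) * I)‖ * (t ^ (-(7 : ℝ) / 4) * Real.exp (π * t / 4)) -
          c₀ * Real.exp (-(π * u / 4))| ≤ C * Real.exp (-(π * u / 4)) * (1 + |u|) / t)
    {t : ℝ} (hT₀ : T₀ ≤ t) (ht : 1 ≤ t) (u : ℝ) :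
    |Real.exp (-(2 * a * |u|)) *
      (‖xiGammaFactor (1 / 2 + ((t + u : ℝ) : ℂ) * I)‖ * (t ^ (-(7 : ℝ) / 4) * Real.exp (π * t / 4)) -
        c₀ * Real.exp (-(π * u / 4)))| ≤
      (max C 0 + 4 * (9 * C₀ + c₀)) / t * ((1 + |u|) ^ 4 * KT(a, u)) := by
  have ht0 : 0 < t := by linarith
  have hu0 : 0 ≤ |u| := abs_nonneg u
  have hu1 : 1 ≤ 1 + |u| := by linarith
  have hC₀0 : 0 ≤ C₀ := by
    have h := (norm_nonneg _).trans (hC₀ 0)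
    simpa using h
  set K : ℝ := Real.exp (-(2 * a * |u|)) with hK
  have hK0 : 0 < K := Real.exp_pos _
  have hκ : 0 < K * Real.exp (-(π * u / 4)) := mul_pos hK0 (Real.exp_pos _)
  set E : ℝ := ‖xiGammaFactor (1 / 2 + ((t + u : ℝ) : ℂ) * I)‖ with hE
  set w : ℝ := t ^ (-(7 : ℝ) / 4) * Real.exp (π * t / 4) with hw
  have hw0 : 0 < w := by positivity
  have hE0 : 0 ≤ E := norm_nonneg _
  have hmax : 0 ≤ max C 0 := le_max_right _ _
  rcases le_or_gt |u| (t / 2) with hu | hu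
  · -- the bulk `|u| ≤ t/2`
    have h1 := henv t hT₀ u hu
    rw [abs_mul, abs_of_pos hK0]
    calc K * |E * w - c₀ * Real.exp (-(π * u / 4))|
        ≤ K * (C * Real.exp (-(π * u / 4)) * (1 + |u|) / t) := mul_le_mul_of_nonneg_left h1 hK0.le
      _ = C / t * ((1 + |u|) * (K * Real.exp (-(π * u / 4)))) := by ring
      _ ≤ max C 0 / t * ((1 + |u|) ^ 4 * (K * Real.exp (-(π * u / 4)))) := by
          have h2 : C / t ≤ max C 0 / t := div_le_div_of_nonneg_right (le_max_left _ _) ht0.le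
          have h3 : (1 + |u|) * (K * Real.exp (-(π * u / 4))) ≤
              (1 + |u|) ^ 4 * (K * Real.exp (-(π * u / 4))) := by
            refine mul_le_mul_of_nonneg_right ?_ hκ.le
            calc (1 + |u|) = (1 + |u|) ^ 1 := (pow_one _).symm
              _ ≤ (1 + |u|) ^ 4 := pow_le_pow_right₀ hu1 (by norm_num)
          calc C / t * ((1 + |u|) * (K * Real.exp (-(π * u / 4))))
              ≤ max C 0 / t * ((1 + |u|) * (K * Real.exp (-(π * u / 4)))) :=
                mul_le_mul_of_nonneg_right h2 (by positivity)
            _ ≤ max C 0 / t * ((1 + |u|) ^ 4 * (K * Real.exp (-(π * u / 4)))) :=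
                mul_le_mul_of_nonneg_left h3 (by positivity)
      _ ≤ (max C 0 + 4 * (9 * C₀ + c₀)) / t * ((1 + |u|) ^ 4 * (K * Real.exp (-(π * u / 4)))) := by
          refine mul_le_mul_of_nonneg_right (div_le_div_of_nonneg_right ?_ ht0.le) (by positivity)
          nlinarith
  · -- the tail `|u| > t/2`
    have hA : K * (E * w) ≤ 9 * C₀ * (1 + |u|) ^ 2 * (K * Real.exp (-(π * u / 4))) := by
      have h1 := hC₀ (t + u)
      have h2 : (1 + |t + u|) ^ ((7 : ℝ) / 4) ≤ 9 * (1 + |u|) ^ 2 := by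
        have hb1 : 1 ≤ 1 + |t + u| := by have := abs_nonneg (t + u); linarith
        calc (1 + |t + u|) ^ ((7 : ℝ) / 4) ≤ (1 + |t + u|) ^ ((2 : ℕ) : ℝ) :=
              Real.rpow_le_rpow_of_exponent_le hb1 (by norm_num)
          _ = (1 + |t + u|) ^ 2 := Real.rpow_natCast _ 2
          _ ≤ (3 * (1 + |u|)) ^ 2 := by
              refine pow_le_pow_left₀ (by positivity) ?_ 2
              have h3 := abs_add_le t u
              rw [abs_of_pos ht0] at h3
              linarith
          _ = 9 * (1 + |u|) ^ 2 := by ring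
      have h3 : t ^ (-(7 : ℝ) / 4) ≤ 1 := Real.rpow_le_one_of_one_le_of_nonpos ht (by norm_num)
      have h4 : K * Real.exp (-(π * |t + u| / 4)) * Real.exp (π * t / 4) ≤
          K * Real.exp (-(π * u / 4)) := by
        rw [mul_assoc, ← Real.exp_add]
        refine mul_le_mul_of_nonneg_left (Real.exp_le_exp.2 ?_) hK0.le
        have h5 := le_abs_self (t + u)
        have hπ := Real.pi_pos
        nlinarith
      have h6 : 0 ≤ t ^ (-(7 : ℝ) / 4) := by positivity
      calc K * (E * w)
          ≤ K * ((C₀ * (1 + |t + u|) ^ ((7 : ℝ) / 4) * Real.exp (-(π * |t + u| / 4))) * w) := by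
            refine mul_le_mul_of_nonneg_left (mul_le_mul_of_nonneg_right h1 hw0.le) hK0.le
        _ = C₀ * ((1 + |t + u|) ^ ((7 : ℝ) / 4) * t ^ (-(7 : ℝ) / 4)) *
              (K * Real.exp (-(π * |t + u| / 4)) * Real.exp (π * t / 4)) := by
            simp only [hw]; ring
        _ ≤ C₀ * (9 * (1 + |u|) ^ 2 * 1) * (K * Real.exp (-(π * u / 4))) := by
            refine mul_le_mul (mul_le_mul_of_nonneg_left ?_ hC₀0) h4 (by positivity) (by positivity)
            exact mul_le_mul h2 h3 h6 (by positivity)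
        _ = 9 * C₀ * (1 + |u|) ^ 2 * (K * Real.exp (-(π * u / 4))) := by ring
    have hB : c₀ * Real.exp (-(π * u / 4)) ≤ c₀ * (1 + |u|) ^ 2 * Real.exp (-(π * u / 4)) := by
      have h1 : (1 : ℝ) ≤ (1 + |u|) ^ 2 := one_le_pow₀ hu1
      have he := Real.exp_pos (-(π * u / 4))
      have h2 := mul_le_mul_of_nonneg_left h1 (mul_pos hc₀ he).le
      linarith
    have htu : t ≤ 4 * (1 + |u|) ^ 2 := by nlinarith
    calc |K * (E * w - c₀ * Real.exp (-(π * u / 4)))|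
        = K * |E * w - c₀ * Real.exp (-(π * u / 4))| := by rw [abs_mul, abs_of_pos hK0]
      _ ≤ K * (E * w + c₀ * Real.exp (-(π * u / 4))) := by
          refine mul_le_mul_of_nonneg_left ((abs_sub _ _).trans ?_) hK0.le
          rw [abs_of_nonneg (by positivity), abs_of_nonneg (by positivity)]
      _ = K * (E * w) + K * (c₀ * Real.exp (-(π * u / 4))) := by ring
      _ ≤ 9 * C₀ * (1 + |u|) ^ 2 * (K * Real.exp (-(π * u / 4))) +
            K * (c₀ * (1 + |u|) ^ 2 * Real.exp (-(π * u / 4))) :=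
          add_le_add hA (mul_le_mul_of_nonneg_left hB hK0.le)
      _ = (9 * C₀ + c₀) * (1 + |u|) ^ 2 * (K * Real.exp (-(π * u / 4))) * t / t := by
          field_simp
      _ ≤ (9 * C₀ + c₀) * (1 + |u|) ^ 2 * (K * Real.exp (-(π * u / 4))) * (4 * (1 + |u|) ^ 2) / t := by
          refine div_le_div_of_nonneg_right (mul_le_mul_of_nonneg_left htu ?_) ht0.le
          positivity
      _ = 4 * (9 * C₀ + c₀) / t * ((1 + |u|) ^ 4 * (K * Real.exp (-(π * u / 4)))) := by ring
      _ ≤ (max C 0 + 4 * (9 * C₀ + c₀)) / t * ((1 + |u|) ^ 4 * (K * Real.exp (-(π * u / 4)))) := by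
          refine mul_le_mul_of_nonneg_right (div_le_div_of_nonneg_right ?_ ht0.le) (by positivity)
          linarith

end Summit.RiemannHypothesis.RiemannHypothesis.Theorems
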